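import Summits.QuantumFields.YangMills.Theorems.IR.BlockedActivityKPCounting
import Summits.QuantumFields.YangMills.Theorems.IR.BlockedActivityTyp
import HarnessLib

/-!
# Crux `IR` (stmt-QuantumFields-19354), lane B «strong coupling AFTER BLOCKING»: the KOTECKÝ–PREISS-GRADE constant of the reduction
# (part 2/2: the lane's cells, `Δ = 81`, `#T ≤ 82`; owner R98 (1))

Helper module for item `stmt-QuantumFields-19354` (`--supports`; it closes nothing), lane `ym-19354-onsetsc-p2`; second-generation
constant for `Theorems/IR/BlockedActivityUnivShellCond` (p528785) and `…BlockedActivityTyp` (p532761), from the abstract sharp bound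
`KP.norm_pertExpect_sub_integral_le_sharp` (part 1/2, `Theorems/IR/BlockedActivityKPCounting`).

* `kp_numerics` — at `Δ = 81`: `0 ≤ a`, `13448 e a ≤ 1` (`13448 = 2·82²`), `t ≤ 82` ⇒ the two smallness conditions of the sharp bound and
  its right-hand side (at `B = 1`) `≤ 656 e² a` (`fug a 81 ≤ e a`, `(1+2·fug)^{82} − 1 ≤ 328 e a`, `e^{13448 e a} ≤ e`).
* `BlockedRepOn.norm_integral_sub_ref_le_sharp` (`‖E_σ f − ref‖ ≤ 656 e² a` for `σ ∈ S`), `…abs_integral_sub_integral_le_sharp` (`≤ 1312 e² a`).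
* **`radiusKP ε = ε ∕ (13448 e²)`**, `radiusKP_pos`, `smallness_radiusKP` (`a ≤ radiusKP ε`, `ε ≤ 1` ⇒ `13448 e a ≤ 1 ∧ 1312 e² a ≤ ε`), the
  certified enclosure **`radiusKP_bounds : ε∕10⁵ < radiusKP ε < ε∕98000`** (`e ∈ (2.71, 2.72)`).
* **`univShellCond_of_blockedActivity_sharp : BlockedActivityClass ρ β b n a → ε ≤ 1 → a ≤ radiusKP ε → OnsetFormats.UnivShellCond ρ β b n ε`**,
  **`clauseI_of_blockedActivityTyp_sharp`**, `clauseIAll_of_blockedActivityTypAll_sharp` — the reductions of p528785 ∕ p532761 at the sharp radius.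
THE NUMBER, updated: the activity radius the weak side must deliver per cell at the bootstrap accuracy `ε = 1/3552` is
`a⋆ = radiusKP (1/3552) ∈ (2.8·10⁻⁹, 2.9·10⁻⁹)` (Dobrushin-exclusion version: `radius (1/3552) ≈ 1.4·10⁻⁸⁹`, `Theorems/IR/BlockedActivityCalibration`
§6); the remaining `(Δ+1)² = 6724` is the price of sup-adjacency in `ℤ⁴` (`Δ = 81`).

HONEST FRAMING: a sharper constant in a reduction among OPEN statements; no blocked-activity bound is claimed for Yang–Mills at any `β`; not
a gap, not Clay.  No `sorry`; axioms ⊆ {propext, Classical.choice, Quot.sound}; no instances, no notation.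
Refs: KoteckyPreiss1986 (1); FriedliVelenik2017 §5.7.1; OsterwalderSeilerAnnPhys1978 §3.
-/

set_option autoImplicit false

noncomputable section

open MeasureTheory ProbabilityTheory Finset
open Literature.MathematicalPhysics.QuantumFieldTheory (cofree)
open Literature.MathematicalPhysics.QuantumLattice (LGConfig ymSpecification)
open Literature.Probability.LatticeModels
open Summit.QuantumFields.YangMills.Cruxes.IR.Tempered (cellEdges windowCells regionEdges)
open Summit.QuantumFields.YangMills.Cruxes.IR.OnsetFormats (UnivShellCond)
open Summit.QuantumFields.YangMills.Cruxes.IR.FixedMesh (ClauseI)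
open Summit.QuantumFields.YangMills.Cruxes.IR.AfPincerUc (ClauseIAll)


/-! ## §3 Lane B with the Kotecký–Preiss-grade constant: `Δ = 81`, `#T ≤ 82` -/

namespace Summit.QuantumFields.YangMills.Cruxes.IR.BlockedActivity

open KP

/-- Numerics at `Δ = 81`: for `0 ≤ a` with `13448 e a ≤ 1` (`13448 = 2 · 82²`) and `t ≤ 82`, the two smallness conditions of the
sharp bound hold and its right-hand side (with `B = 1`) is `≤ 656 e² a`. -/
theorem kp_numerics {a : ℝ} (ha : 0 ≤ a) (hA : 13448 * Real.exp 1 * a ≤ 1) {t : ℕ} (ht : t ≤ 82) :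
    Real.exp 1 * a * ((81 : ℕ) + 1 : ℝ) ^ 2 ≤ 1 / 2 ∧ (1 + 2 * fug a 81) ^ 81 ≤ 2 ∧
      2 * (1 : ℝ) * Real.exp (t * ((81 : ℕ) + 1 : ℝ) * (2 * (Real.exp 1 * a))) * ((1 + 2 * fug a 81) ^ t - 1) ≤
        656 * Real.exp 1 ^ 2 * a := by
  have he0 : 0 < Real.exp 1 := Real.exp_pos 1
  have he1 : 1 ≤ Real.exp 1 := by have := Real.add_one_le_exp (1 : ℝ); linarith
  have hea : Real.exp 1 * a ≤ 1 / 13448 := by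
    rw [le_div_iff₀ (by norm_num : (0 : ℝ) < 13448)]; linarith
  have hea0 : 0 ≤ Real.exp 1 * a := by positivity
  -- the renormalised fugacity
  have hexp1 : Real.exp (2 * (Real.exp 1 * a) * ((81 : ℝ) + 1) ^ 2) ≤ Real.exp 1 :=
    Real.exp_le_exp.2 (by nlinarith)
  have hfug0 : 0 ≤ fug a 81 := fug_nonneg ha 81
  have hfug : fug a 81 ≤ Real.exp 1 * a := by
    unfold fug
    have : (((81 : ℕ) : ℝ) + 1) = (81 : ℝ) + 1 := by norm_num
    rw [this]
    calc a * Real.exp (2 * (Real.exp 1 * a) * ((81 : ℝ) + 1) ^ 2) ≤ a * Real.exp 1 :=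
          mul_le_mul_of_nonneg_left hexp1 ha
      _ = Real.exp 1 * a := mul_comm _ _
  have h1fug : (1 : ℝ) ≤ 1 + 2 * fug a 81 := by linarith
  -- `(1 + 2 fug)^k ≤ exp (2 k fug)` and `exp u − 1 ≤ 2u` for `u ≤ 1`
  have hpowexp : ∀ k : ℕ, (1 + 2 * fug a 81) ^ k ≤ Real.exp (2 * k * fug a 81) := fun k => by
    have h := Real.add_one_le_exp (2 * fug a 81)
    calc (1 + 2 * fug a 81) ^ k ≤ Real.exp (2 * fug a 81) ^ k :=
          pow_le_pow_left₀ (by linarith) (by linarith) k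
      _ = Real.exp (2 * k * fug a 81) := by rw [← Real.exp_nat_mul]; ring_nf
  have hsub1 : ∀ u : ℝ, 0 ≤ u → u ≤ 1 → Real.exp u - 1 ≤ 2 * u := fun u hu0 hu1 => by
    have h := Real.abs_exp_sub_one_le (x := u) (by rw [abs_of_nonneg hu0]; exact hu1)
    rw [abs_of_nonneg hu0] at h
    exact (le_abs_self _).trans h
  refine ⟨?_, ?_, ?_⟩
  · -- `e a 82² = 6724 e a ≤ 1/2`
    have : (((81 : ℕ) : ℝ) + 1) ^ 2 = 6724 := by norm_num
    rw [this]; linarith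
  · -- `(1 + 2 fug)^81 ≤ exp (162 fug) ≤ 1 + 2 · 162 fug ≤ 2`
    have hu1 : 2 * (81 : ℕ) * fug a 81 ≤ 1 := by push_cast; nlinarith
    have hu0 : 0 ≤ 2 * (81 : ℕ) * fug a 81 := by positivity
    have := hsub1 _ hu0 hu1
    have h81 := hpowexp 81
    push_cast at this hu1 h81 ⊢
    nlinarith
  · -- the right-hand side
    have hexpT : Real.exp (t * ((81 : ℕ) + 1 : ℝ) * (2 * (Real.exp 1 * a))) ≤ Real.exp 1 := by
      refine Real.exp_le_exp.2 ?_
      have ht' : (t : ℝ) ≤ 82 := by exact_mod_cast ht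
      have : (((81 : ℕ) : ℝ) + 1) = 82 := by norm_num
      rw [this]
      calc (t : ℝ) * 82 * (2 * (Real.exp 1 * a)) ≤ 82 * 82 * (2 * (Real.exp 1 * a)) := by
            gcongr
        _ = 13448 * (Real.exp 1 * a) := by ring
        _ ≤ 1 := by linarith
    have hpow : (1 + 2 * fug a 81) ^ t - 1 ≤ 328 * (Real.exp 1 * a) := by
      have hmono : (1 + 2 * fug a 81) ^ t ≤ (1 + 2 * fug a 81) ^ 82 := pow_le_pow_right₀ h1fug ht
      have h82 := hpowexp 82
      have hu1 : 2 * (82 : ℕ) * fug a 81 ≤ 1 := by push_cast; nlinarith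
      have hu0 : 0 ≤ 2 * (82 : ℕ) * fug a 81 := by positivity
      have := hsub1 _ hu0 hu1
      push_cast at this hu1 h82 ⊢
      nlinarith
    have hpow0 : 0 ≤ (1 + 2 * fug a 81) ^ t - 1 := by
      have := one_le_pow₀ (n := t) h1fug; linarith
    calc 2 * (1 : ℝ) * Real.exp (t * ((81 : ℕ) + 1 : ℝ) * (2 * (Real.exp 1 * a))) * ((1 + 2 * fug a 81) ^ t - 1)
        ≤ 2 * 1 * Real.exp 1 * (328 * (Real.exp 1 * a)) :=
          mul_le_mul (by nlinarith [Real.exp_pos (t * ((81 : ℕ) + 1 : ℝ) * (2 * (Real.exp 1 * a)))]) hpow hpow0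
            (by positivity)
      _ = 656 * Real.exp 1 ^ 2 * a := by ring

section LaneB

variable {G : Type} [Group G] [TopologicalSpace G] [IsTopologicalGroup G] [CompactSpace G]
  [MeasurableSpace G] [BorelSpace G] {N : ℕ} {ρ : G →* Matrix (Fin N) (Fin N) ℂ} {β : ℝ}
  {w : Fin 4 → ℤ → ℤ} {Y : Finset Cell} {a ε : ℝ} {S : Set (LGConfig 4 G)}

/-- At most `82` cells touch the centre cell. -/
theorem card_touchCells_centre_le (C : Finset Cell) : (touchCells CellAdj ({0} : Finset Cell) C).card ≤ 82 :=
  (card_touchCells_le (R := CellAdj) card_cellNbr_le mem_cellNbr_of_cellAdj {0} C).trans (by simp)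

/-- **The Kotecký–Preiss step, sharp constant**: for data `σ ∈ S` and `13448 e a ≤ 1`, the centre-cell kernel expectation is within
`656 e² a` of the σ-independent reference value (against `2 e a 2⁸¹ (2e)⁸²` in `BlockedRepOn.norm_integral_sub_ref_le`). -/
theorem BlockedRepOn.norm_integral_sub_ref_le_sharp (R : BlockedRepOn ρ β w Y a S) (hA : 13448 * Real.exp 1 * a ≤ 1)
    {σ : LGConfig 4 G} (hσ : σ ∈ S) {f : LGConfig 4 G → ℝ} (hf : IsCentreObs w f) :
    ‖((∫ U, f U ∂(ymSpecification ρ β (regionEdges w Y) σ) : ℝ) : ℂ) - ∫ ω, R.obs f ω ∂(R.μ)‖ ≤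
      656 * Real.exp 1 ^ 2 * a := by
  letI := R.mΩ
  haveI := R.isProb
  have ha : 0 ≤ a := (R.perturbation σ hσ).nonneg
  obtain ⟨c1, c3, cfin⟩ := kp_numerics ha hA (card_touchCells_centre_le R.C)
  have h := KP.norm_pertExpect_sub_integral_le_sharp (R := CellAdj) (nbr := cellNbr) (Δ := 81) cellAdj_symm card_cellNbr_le
    mem_cellNbr_of_cellAdj (R.perturbation σ hσ) (R.obs_local f hf) c1 c3 R.C
  rw [R.rep σ hσ f hf]
  exact h.trans cfin

/-- Two data in `S` move the centre-cell kernel expectation by at most `1312 e² a` (sharp constant). -/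
theorem BlockedRepOn.abs_integral_sub_integral_le_sharp (R : BlockedRepOn ρ β w Y a S) (hA : 13448 * Real.exp 1 * a ≤ 1)
    {σ σ' : LGConfig 4 G} (hσ : σ ∈ S) (hσ' : σ' ∈ S) {f : LGConfig 4 G → ℝ} (hf : IsCentreObs w f) :
    |(∫ U, f U ∂(ymSpecification ρ β (regionEdges w Y) σ)) - ∫ U, f U ∂(ymSpecification ρ β (regionEdges w Y) σ')| ≤
      1312 * Real.exp 1 ^ 2 * a := by
  have hA' := R.norm_integral_sub_ref_le_sharp hA hσ hf
  have hB' := R.norm_integral_sub_ref_le_sharp hA hσ' hf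
  set E : ℂ := ((∫ U, f U ∂(ymSpecification ρ β (regionEdges w Y) σ) : ℝ) : ℂ) with hE
  set E' : ℂ := ((∫ U, f U ∂(ymSpecification ρ β (regionEdges w Y) σ') : ℝ) : ℂ) with hE'
  set I : ℂ := ∫ ω, R.obs f ω ∂(R.μ) with hI
  have hdiff : ‖E - E'‖ ≤ 1312 * Real.exp 1 ^ 2 * a := by
    calc ‖E - E'‖ = ‖(E - I) - (E' - I)‖ := by ring_nf
      _ ≤ ‖E - I‖ + ‖E' - I‖ := norm_sub_le _ _
      _ ≤ 656 * Real.exp 1 ^ 2 * a + 656 * Real.exp 1 ^ 2 * a := add_le_add hA' hB'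
      _ = _ := by ring
  have hreal : ‖E - E'‖ = |(∫ U, f U ∂(ymSpecification ρ β (regionEdges w Y) σ)) -
      ∫ U, f U ∂(ymSpecification ρ β (regionEdges w Y) σ')| := by
    rw [hE, hE', ← Complex.ofReal_sub, Complex.norm_real, Real.norm_eq_abs]
  rw [← hreal]
  exact hdiff

/-- **THE SHARP NUMBER**: the activity radius `a_KP(ε) = ε ∕ (13448 e²)` (`≈ ε · 10⁻⁵`), against the Dobrushin-exclusion radius
`radius ε = ε ∕ (4e·2⁸¹·(2e)⁸²) ≈ ε · 10⁻⁸⁵·⁷` of `BlockedActivityUnivShellCond`: the waste `2^Δ (2e)^{Δ+1}` of the Peierls count is replaced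
by the lattice-animal count `(1 + 2eε)^{Δ+1} − 1 = O(Δ ε)`. -/
def radiusKP (ε : ℝ) : ℝ := ε / (13448 * Real.exp 1 ^ 2)

omit [TopologicalSpace G] [IsTopologicalGroup G] [CompactSpace G] [MeasurableSpace G] [BorelSpace G] in
/-- The sharp radius is positive for positive `ε`. -/
theorem radiusKP_pos (hε : 0 < ε) : 0 < radiusKP ε := by unfold radiusKP; positivity

omit [TopologicalSpace G] [IsTopologicalGroup G] [CompactSpace G] [MeasurableSpace G] [BorelSpace G] in
/-- At `a ≤ a_KP(ε)`, `ε ≤ 1`: the smallness `13448 e a ≤ 1` and the accuracy `1312 e² a ≤ ε`. -/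
theorem smallness_radiusKP (ha : 0 ≤ a) (hε1 : ε ≤ 1) (haε : a ≤ radiusKP ε) :
    13448 * Real.exp 1 * a ≤ 1 ∧ 1312 * Real.exp 1 ^ 2 * a ≤ ε := by
  have he0 : 0 < Real.exp 1 := Real.exp_pos 1
  have he1 : 1 ≤ Real.exp 1 := by have := Real.add_one_le_exp (1 : ℝ); linarith
  have hD : 0 < 13448 * Real.exp 1 ^ 2 := by positivity
  have hmul : 13448 * Real.exp 1 ^ 2 * a ≤ ε := by
    have := mul_le_mul_of_nonneg_left haε hD.le
    unfold radiusKP at this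
    rwa [mul_div_cancel₀ _ hD.ne'] at this
  constructor
  · nlinarith
  · nlinarith

omit [TopologicalSpace G] [IsTopologicalGroup G] [CompactSpace G] [MeasurableSpace G] [BorelSpace G] in
/-- Certified decimal enclosure: `ε ∕ 10⁵ < a_KP(ε) < ε ∕ 98000` for `ε > 0` (`e² ∈ (7.3441, 7.3984)`). -/
theorem radiusKP_bounds (hε : 0 < ε) : ε / 100000 < radiusKP ε ∧ radiusKP ε < ε / 98000 := by
  have h1 : (2.71 : ℝ) < Real.exp 1 := by have := Real.exp_one_gt_d9; linarith
  have h2 : Real.exp 1 < (2.72 : ℝ) := by have := Real.exp_one_lt_d9; linarith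
  have hlo : (98000 : ℝ) < 13448 * Real.exp 1 ^ 2 := by nlinarith
  have hhi : 13448 * Real.exp 1 ^ 2 < (100000 : ℝ) := by nlinarith
  unfold radiusKP
  exact ⟨div_lt_div_of_pos_left hε (by positivity) hhi, div_lt_div_of_pos_left hε (by positivity) hlo⟩

/-- **Adapter, sharp constant**: the Typ-relativised class at radius `a ≤ a_KP(ε)` (`ε ≤ 1`) gives clause (i). -/
theorem clauseI_of_blockedActivityTyp_sharp {n : ℕ} {Typ : Cell → Set (LGConfig 4 G)} (hC : BlockedActivityTyp ρ β w n a Typ)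
    (hε1 : ε ≤ 1) (haε : a ≤ radiusKP ε) : ClauseI ρ β w n ε Typ := by
  intro Y hY h0 σ σ' htyp _ f hf hfm hf01
  obtain ⟨R⟩ := hC Y hY h0
  have ha0 : 0 ≤ a := (R.perturbation σ fun c hc hcY => (htyp c hc hcY).1).nonneg
  obtain ⟨hA, hacc⟩ := smallness_radiusKP ha0 hε1 haε
  exact (R.abs_integral_sub_integral_le_sharp hA (fun c hc hcY => (htyp c hc hcY).1) (fun c hc hcY => (htyp c hc hcY).2)
    ⟨hf, hfm, hf01⟩).trans hacc

/-- … and at every centre. -/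
theorem clauseIAll_of_blockedActivityTypAll_sharp {n : ℕ} {Typ : Cell → Set (LGConfig 4 G)}
    (hC : BlockedActivityTypAll ρ β w n a Typ) (hε1 : ε ≤ 1) (haε : a ≤ radiusKP ε) : ClauseIAll ρ β w n ε Typ :=
  fun c₀ => clauseI_of_blockedActivityTyp_sharp (hC c₀) hε1 haε

/-- **Lane B reduction, sharp constant**: the σ-uniform class at radius `a ≤ a_KP(ε) = ε ∕ (13448 e²)` (`ε ≤ 1`) gives
`OnsetFormats.UnivShellCond ρ β b n ε`. -/
theorem univShellCond_of_blockedActivity_sharp {b n : ℕ} (hC : BlockedActivityClass ρ β b n a) (hε1 : ε ≤ 1)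
    (haε : a ≤ radiusKP ε) : UnivShellCond ρ β b n ε := by
  intro w hw Y hY h0 σ σ' _ f hf hfm hf01
  obtain ⟨R⟩ := hC w hw Y hY h0
  have ha0 : 0 ≤ a := (R.perturbation σ).nonneg
  obtain ⟨hA, hacc⟩ := smallness_radiusKP ha0 hε1 haε
  exact ((blockedRepOn_of_blockedRep R Set.univ).abs_integral_sub_integral_le_sharp hA (Set.mem_univ σ) (Set.mem_univ σ')
    ⟨hf, hfm, hf01⟩).trans hacc

end LaneB

end Summit.QuantumFields.YangMills.Cruxes.IR.BlockedActivity

end
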